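import Summits.QuantumFields.YangMills.Theorems.BalabanUVNodesN18AveragedFactorPlaqLetters
import Summits.QuantumFields.YangMills.Theorems.BalabanUVNodesN18LocalGaugeOnTransport
import HarnessLib

/-!
# BalabanUVNodes ∕ node N18 = NE5 — closure-ledger item (iii): THE (1.12) LETTER OF THE AVERAGED FACTOR AT THE TABLE OF RECORD, AND CONDITION (i) ONE RUN UP —
# the `localGauge` field of `CondI` for `U_A = fieldShift (avgUnits U)` on the (1.12) cubes of run A's domain `Y` from run B's condition (i) on `π(j, Y)` (this seat's
# g2 ★★★ `localGaugeOn_transportRaw_of_localGaugeOn`, 19c's cube dictionary), assembled with FILE D's `gValued` ∕ `plaq_lt` into `CondI (suModel N) (frameI … Y) cA α₀A U_A`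
# (Track A, DAG node N18 = `T4OutputRate.NE5` :211; cluster K4 «SpineRates», item K3⁷ `SpineGivenEndpointR13SepCoPH`; seat pub-ymgap-dag-n18-w3 g4)

HONEST FRAMING.  Count-neutral kernel bookkeeping (`--supports stmt-QuantumFields-20544 --as helper`): composition BY NAME — this seat's g2 FILE 7
`YMDAG.N18.AvgPotential.localGaugeOn_transportRaw_of_localGaugeOn` ([Balaban1987RG1] (1.12) one run up, clause to clause, in def-P11's `Sect2.LocalGaugeOn` currency), 19c's
`YMDAG.N18.TwoRunCubes.regionOfSet_preimage_mem_cubesI_succ` (run B's (1.12) cube over a run-A cube), FILE D's `avgUnits_factor_eq_ιSU_avgFun` ∕ `…_frameBond` ∕ `…_framePlaq`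
(the averaged factor is `ιSU` of the (0.4) average of record of its `SU(N)` lift).  The RESULT is condition (i) of [Balaban1987RG1] p. 262 for the candidate factor
`U_A = fieldShift (avgUnits U)` of FILE 7's `hletters` at run A's frame of record, from run B's condition (i) and DISPLAYED numerics relating the two runs' radii ∕ thresholds
(the radii step law of the record is NOT derived here).  The factorisation `Ū = (exp iξ′A′)·U_A`, the letters of `A′` and the plaquette letter of `Ū` ([Balaban1985Averaging]
Prop. 3) are NOT here.  Nothing of Bałaban's renormalization group is asserted; NE5 NOT PRINTED ∕ NOT proved; N18 NOT discharged; nothing about the continuum ∕ OS ∕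
mass gap ∕ Clay.

WHAT.
* §1 `exists_su_lift_transf` (a `G`-valued gauge transformation is `ιSU ∘ u′`), ★ `localGaugeOn_lift_of_condI` (run B's (1.12) clause on a cube `regionOfSet W` of the frame,
  read as `Sect2.LocalGaugeOn W ξ (cB·α₀) V` for the `SU(N)` lift `V` of the factor).
* §2 ★★★ `localGauge_fieldShift_avgUnits_factor_frameCubes`: for `Y ∈ 𝐃_j` of run A and the factor `U` of condition (i) of run B on `frameI Rz M (j+1) (domSites π(j,Y))`
  (constants `cB`, radius `α₀`), on EVERY (1.12) cube `C ∈ cubesI M j (domSites Y)` of run A there are a `G`-valued `u` and a potential `A` with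
  `(U_A)^u = exp i(Lξ)A`, `|A|, |∇^{Lξ}A| < t′` on `C`, under the displayed numerics of g2's lemma (`0 < ξ`, `0 ≤ cB·α₀`, `48ℓξ·cBα₀ ≤ 1`, `4ℓξ·cBα₀ < δ_N`,
  `2Nξ·cBα₀ < π`, `L·cBα₀ + 3200ℓ²ξ(cBα₀)² < L·t′`) and the two-block guard `(((d+2)L)²∕4)·α₀ξ² < δ_N` (`ℓ = (d+2)L`).
* §3 `L_mul_eta_succ` (`L·η^{B}_{j+1} = η^{A}_j`), ★★★★ `condI_fieldShift_avgUnits_factor`: `CondI (suModel N) (frameI RzA M j (domSites Y)) (StepConsts.ofParams (F.P k) cA j) α₀A U_A`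
  from run B's `CondI (suModel N) (frameI Rz M (j+1) (domSites π(j,Y))) (StepConsts.ofParams (F.P (k+1)) cB (j+1)) α₀ U` and the displayed numerics
  (`L²·α₀ξ² + 143·((((d+4)L)²∕4)·α₀ξ²)² < α₀A·η_j²`, `t′ = cA·α₀A`, the guards) — the `hI` conjunct of FILE 7's `hletters` for this factor.

0 `def`, 0 `sorry`.  References: T. Bałaban, CMP **109** (1987) 249–301 [Balaban1987RG1] ((1.11)–(1.12) p.262, (0.4) p.253, (0.24)–(0.25) p.257); CMP **98** (1985) 17–51
[Balaban1985Averaging] (Prop. 1 (51) p.26).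
-/

noncomputable section

open scoped BigOperators Matrix.Norms.L2Operator

namespace YMDAG.N18.TransportOfRecord

open Literature.MathematicalPhysics.QuantumFieldTheory.Balaban1983to89
open Literature.MathematicalPhysics.QuantumFieldTheory.Balaban1983to89.T4Continuum
open Literature.MathematicalPhysics.QuantumFieldTheory.Balaban1983to89.T4LevelShift
open Literature.MathematicalPhysics.QuantumFieldTheory.Balaban1983to89.BlockAveraging
open Literature.MathematicalPhysics.QuantumFieldTheory.Balaban1983to89.B12RegularSpaces111
open Literature.MathematicalPhysics.QuantumFieldTheory.Balaban1983to89.B12RegularSpaces111SpecialUnitary (suModel mem_suModel_G)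
open Literature.MathematicalPhysics.QuantumFieldTheory.Balaban1983to89.ExpMeanLog (expMeanLogSU deltaSU)
open Literature.MathematicalPhysics.QuantumFieldTheory.Balaban1983to89.Node00 (MatA ιSU coe_ιSU ιSU_mem_G cubeEnl cubeIndices)
open Literature.MathematicalPhysics.QuantumFieldTheory.Balaban1983to89.Node00.W1
open Literature.MathematicalPhysics.QuantumFieldTheory.Balaban1983to89.Node00.Sect2 (regionOfSet domSys domSites frameI cubesI)
open Literature.MathematicalPhysics.QuantumFieldTheory.Balaban1983to89.B14.Eq213MaximalDomains (side)
open Summit.QuantumFields.BalabanUV.T4Continuum.B13Carriers (transportRaw transportRaw_apply)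

/-! ## §1 Run B's (1.12) clause on a cube, read for the `SU(N)` lift -/

section Lift

variable {P : Params} {N : ℕ}

/-- A `G`-valued (`SU(N)`-valued) gauge transformation with values in `M_N(ℂ)ˣ` is `ιSU ∘ u′`. [cite: Balaban1987RG1, (1.12) p.262 (bookkeeping)] -/
theorem exists_su_lift_transf {i : ℕ} {u : Site P i → (MatA N)ˣ} (hu : ∀ x, u x ∈ (suModel N).G) :
    ∃ u' : GaugeTransf P i (Node00.SU N), ∀ x, u x = ιSU N (u' x) := by
  refine ⟨fun x => ⟨(u x : MatA N), mem_suModel_G.mp (hu x)⟩, fun x => Units.ext ?_⟩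
  rw [coe_ιSU]

/-- ★ **Run B's (1.12) clause on a cube of the frame, for the lift**: if `CondI (suModel N) FB cB α₀ U`, `U = ιSU ∘ V` on the region's bonds, and `regionOfSet W` is a (1.12) cube
of `FB` whose bonds are region bonds, then `Sect2.LocalGaugeOn W cB.ξ (cB.cB·α₀) V`. [cite: Balaban1987RG1, (1.12) p.262] -/
theorem localGaugeOn_lift_of_condI {FB : Frame P 0 (MatA N)} {cB : StepConsts} {α₀ : ℝ} {U : PBond P 0 → (MatA N)ˣ} (hI : CondI (suModel N) FB cB α₀ U)
    {V : GaugeField P 0 (Node00.SU N)} (hV : ∀ b ∈ FB.X.bonds, U b = ιSU N (V b)) (W : Set (Site P 0)) (hC : regionOfSet P W ∈ FB.cubes)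
    (hCX : (regionOfSet P W).bonds ⊆ FB.X.bonds) :
    Node00.Sect2.LocalGaugeOn W cB.ξ (cB.cB * α₀) V := by
  obtain ⟨u, hu, A, he, hA, hdA⟩ := hI.localGauge _ hC
  obtain ⟨u', hu'⟩ := exists_su_lift_transf hu
  refine ⟨u', A, fun b hb => ?_, hA, hdA⟩
  have h := he b hb
  simp only [gaugeU] at h ⊢
  rw [hV b (hCX hb), hu', hu'] at h
  exact h

end Lift

/-! ## §2 The (1.12) letter of the averaged factor on run A's cubes -/

section Record

variable {F : T4Family} {N k : ℕ} [NeZero N]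

/-- ★★★ **(1.12) FOR THE AVERAGED FACTOR ON EVERY (1.12) CUBE OF RUN A's DOMAIN `Y`.**  Let `Y ∈ 𝐃_j` of run A and let `U` be the factor of condition (i) of run B on
`frameI Rz M (j+1) (domSites π(j,Y))` with constants `cB` (unit `ξ = cB.ξ`, threshold `cB.cB·α₀`).  Then on every cube `C ∈ cubesI M j (domSites Y)` there are a `G`-valued gauge
transformation `u` and a potential `A` with `(fieldShift (avgUnits U))^u(b) = exp i(Lξ)A(b)` on `C`'s bonds, `‖A‖ < t′` there and `‖∇^{Lξ}A‖ < t′` on `C`'s stencils — 19c's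
cube over `C` is a (1.12) cube of run B's frame, FILE D identifies the averaged factor with `ιSU` of the transport of record of the lift on `C`'s bonds, and this seat's g2
★★★ carries the clause one run up. [cite: Balaban1987RG1, (1.12) p.262, (0.4) p.253, (0.24)-(0.25) p.257] -/
theorem localGauge_fieldShift_avgUnits_factor_frameCubes (Rz : Node00.Sect2.Residual (F.P (k + 1)) (MatA N)) (M j' : ℕ) (Y : (domSys (F.P k) M j').Dom)
    {cB : StepConsts} {α₀ t' : ℝ} {U : PBond (F.P (k + 1)) 0 → (MatA N)ˣ}
    (hI : CondI (suModel N) (frameI Rz M (j' + 1) (domSites (F.P (k + 1)) M (j' + 1) (pairOfRecord F M k ⟨j', Y⟩).2)) cB α₀ U)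
    (hα₀ : 0 ≤ α₀) (hguard : (((((F.P (k + 1)).d + 2) * (F.P (k + 1)).L : ℕ) : ℝ) ^ 2 / 4) * (α₀ * cB.ξ ^ 2) < deltaSU (Fin N))
    (hξ : 0 < cB.ξ) (ht : 0 ≤ cB.cB * α₀)
    (h48 : 48 * (((((F.P (k + 1)).d + 2) * (F.P (k + 1)).L : ℕ) : ℝ) * (cB.ξ * (cB.cB * α₀))) ≤ 1)
    (hN : 4 * (((((F.P (k + 1)).d + 2) * (F.P (k + 1)).L : ℕ) : ℝ) * (cB.ξ * (cB.cB * α₀))) < deltaSU (Fin N))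
    (hπ : (N : ℝ) * (2 * (cB.ξ * (cB.cB * α₀))) < Real.pi)
    (h1 : ((F.P (k + 1)).L : ℝ) * (cB.cB * α₀) + 3200 * (((((F.P (k + 1)).d + 2) * (F.P (k + 1)).L : ℕ) : ℝ)) ^ 2 * cB.ξ * (cB.cB * α₀) ^ 2 <
      (F.P (k + 1)).L * t') :
    ∀ C ∈ cubesI (P := F.P k) M j' (domSites (F.P k) M j' Y),
      ∃ u : Site (F.P k) 0 → (MatA N)ˣ, (∀ x, u x ∈ (suModel N).G) ∧ ∃ A : PBond (F.P k) 0 → MatA N,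
        (∀ bd ∈ C.bonds, gaugeU u (fieldShift (sitesPerDir_ladder F (K := k) (j := 0) rfl rfl) (avgUnits U)) bd = expI (((F.P (k + 1)).L : ℝ) * cB.ξ) (A bd)) ∧
        (∀ bd ∈ C.bonds, ‖A bd‖ < t') ∧
        ∀ q ∈ C.dpairs, ‖grad (((F.P (k + 1)).L : ℝ) * cB.ξ) q.2.1 (fun y => A ⟨y, q.2.2⟩) q.1‖ < t' := by
  rintro C ⟨a, ha, hne, rfl⟩
  have hj : 0 + 1 ≤ (F.P (k + 1)).m + (F.P (k + 1)).K := by simp only [T4Family.P_m, T4Family.P_K]; omega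
  obtain ⟨V, hV⟩ := exists_su_lift hI
  -- run B's (1.12) cube over this cube and the clause for the lift
  have hCB := YMDAG.N18.TwoRunCubes.regionOfSet_preimage_mem_cubesI_succ (F := F) (k := k) M Y ha hne
  have hLG : Node00.Sect2.LocalGaugeOn ((fun x => (siteShift (YMDAG.N18.TwoRunCubes.ladder F k)).symm (blockOf x)) ⁻¹'
      (cubeEnl (F.P k) (side (F.P k).L M (j' + 1)) a 0 ∩ domSites (F.P k) M j' Y)) cB.ξ (cB.cB * α₀) V :=
    localGaugeOn_lift_of_condI hI hV _ hCB (YMDAG.N18.CombStep.cubesI_bonds_subset hCB)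
  -- one run up
  obtain ⟨u', A, he, hA, hdA⟩ := YMDAG.N18.AvgPotential.localGaugeOn_transportRaw_of_localGaugeOn V _ hLG hξ ht h48 hN hπ h1
  refine ⟨fun x => ιSU N (u' x), fun x => ιSU_mem_G N _, A, fun bd hbd => ?_, hA, hdA⟩
  -- the averaged factor on the cube's bonds is `ιSU` of the transport of record of the lift
  have hbdY : bd ∈ (regionOfSet (F.P k) (domSites (F.P k) M j' Y)).bonds := Node00.Sect2.regionOfSet_bonds_mono Set.inter_subset_right hbd
  have hX : (frameI Rz M (j' + 1) (domSites (F.P (k + 1)) M (j' + 1) (pairOfRecord F M k ⟨j', Y⟩).2)).X =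
      regionOfSet (F.P (k + 1)) ((fun x => (siteShift (YMDAG.N18.TwoRunCubes.ladder F k)).symm (blockOf x)) ⁻¹' domSites (F.P k) M j' Y) := by
    show regionOfSet (F.P (k + 1)) (domSites (F.P (k + 1)) M (j' + 1) (pairOfRecord F M k ⟨j', Y⟩).2) = _
    rw [YMDAG.N18.TwoRunCubes.domSites_pairOfRecord_eq_preimage]
  obtain ⟨yA, μA⟩ := bd
  have hfac : fieldShift (sitesPerDir_ladder F (K := k) (j := 0) rfl rfl) (avgUnits U) ⟨yA, μA⟩ =
      ιSU N (transportRaw F k (blockAvg (expMeanLogSU (n := Fin N))) V ⟨yA, μA⟩) := by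
    rw [fieldShift_apply, transportRaw_apply]
    refine avgUnits_factor_eq_ιSU_avgFun hj hI hV _ (fun b' h1 h2 => ?_) (fun q h1 h2 h3 h4 => ?_) hα₀ hguard
    · rw [hX]; exact YMDAG.N18.AvgPotential.twoBlocks_subset_bonds_preimage F k _ hbdY b' h1 h2
    · rw [hX]; exact twoBlocks_subset_plaqs_preimage _ hbdY q h1 h2 h3 h4
  rw [← he ⟨yA, μA⟩ hbd]
  simp only [gaugeU]
  rw [hfac]

/-! ## §3 Condition (i) one run up, assembled -/

omit [NeZero N] in
/-- `L·η^{B}_{j+1} = η^{A}_j`: run B's unit at its step `j+1` times `L` is run A's unit at its step `j` (both tori have `L = F.L`). [cite: Balaban1987RG1, (1.1) p.260, (0.24) p.257] -/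
theorem L_mul_eta_succ (j' : ℕ) : ((F.P (k + 1)).L : ℝ) * (F.P (k + 1)).eta (j' + 1) = (F.P k).eta j' := by
  simp only [T4Family.P_L, Params.eta, pow_succ]
  have hL : (F.L : ℝ) ≠ 0 := by have := F.hL.2; positivity
  field_simp

/-- ★★★★ **CONDITION (i) OF [Balaban1987RG1] p. 262 FOR THE AVERAGED FACTOR AT RUN A's FRAME OF RECORD, FROM RUN B's CONDITION (i) AND NUMERICS.**  Let `Y ∈ 𝐃_j` of run A,
`π(j, Y)` its paired domain of run B, `U` the factor of `CondI (suModel N) (frameI Rz M (j+1) (domSites π(j,Y))) (StepConsts.ofParams (F.P (k+1)) cB (j+1)) α₀ U` (unit `ξ = η_{j+1}`,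
threshold `cB·α₀`), and `U_A := fieldShift (avgUnits U)` (W1-18's transport of the `𝐔`-slot, `TΦOfRecord_U`).  Under the displayed numerics — the two guards of the (0.4) average,
g2's chart conditions at `t = cB·α₀`, the plaquette radius `L²·α₀ξ² + 143·((((d+4)L)²∕4)·α₀ξ²)² < α₀A·η_j²` and the threshold `L·cBα₀ + 3200ℓ²ξ(cBα₀)² < L·(cA·α₀A)` —
`CondI (suModel N) (frameI RzA M j (domSites Y)) (StepConsts.ofParams (F.P k) cA j) α₀A U_A`: `gValued` and `plaq_lt` by FILE D, `localGauge` by §2 (`L·η_{j+1} = η_j`).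
This is the `hI` conjunct of FILE 7's `hletters` for this candidate factor; the radii step law making the numerics hold along the record is NOT derived here.
[cite: Balaban1987RG1, (1.11)-(1.12) p.262, (0.4) p.253; Balaban1985Averaging, Prop. 1 (51) p.26] -/
theorem condI_fieldShift_avgUnits_factor (Rz : Node00.Sect2.Residual (F.P (k + 1)) (MatA N)) (RzA : Node00.Sect2.Residual (F.P k) (MatA N)) (M j' : ℕ)
    (Y : (domSys (F.P k) M j').Dom) {cB cA α₀ α₀A : ℝ} {U : PBond (F.P (k + 1)) 0 → (MatA N)ˣ}
    (hI : CondI (suModel N) (frameI Rz M (j' + 1) (domSites (F.P (k + 1)) M (j' + 1) (pairOfRecord F M k ⟨j', Y⟩).2))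
      (StepConsts.ofParams (F.P (k + 1)) cB (j' + 1)) α₀ U)
    (hα₀ : 0 ≤ α₀) (ht : 0 ≤ cB * α₀)
    (hguard2 : (((((F.P (k + 1)).d + 2) * (F.P (k + 1)).L : ℕ) : ℝ) ^ 2 / 4) * (α₀ * (F.P (k + 1)).eta (j' + 1) ^ 2) < deltaSU (Fin N))
    (hguard4 : (((((F.P (k + 1)).d + 4) * (F.P (k + 1)).L : ℕ) : ℝ) ^ 2 / 4) * (α₀ * (F.P (k + 1)).eta (j' + 1) ^ 2) ≤ deltaSU (Fin N) / 2)
    (hplaq : ((F.P (k + 1)).L : ℝ) ^ 2 * (α₀ * (F.P (k + 1)).eta (j' + 1) ^ 2) +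
        143 * ((((((F.P (k + 1)).d + 4) * (F.P (k + 1)).L : ℕ) : ℝ) ^ 2 / 4) * (α₀ * (F.P (k + 1)).eta (j' + 1) ^ 2)) ^ 2 < α₀A * (F.P k).eta j' ^ 2)
    (h48 : 48 * (((((F.P (k + 1)).d + 2) * (F.P (k + 1)).L : ℕ) : ℝ) * ((F.P (k + 1)).eta (j' + 1) * (cB * α₀))) ≤ 1)
    (hN : 4 * (((((F.P (k + 1)).d + 2) * (F.P (k + 1)).L : ℕ) : ℝ) * ((F.P (k + 1)).eta (j' + 1) * (cB * α₀))) < deltaSU (Fin N))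
    (hπ : (N : ℝ) * (2 * ((F.P (k + 1)).eta (j' + 1) * (cB * α₀))) < Real.pi)
    (h1 : ((F.P (k + 1)).L : ℝ) * (cB * α₀) + 3200 * (((((F.P (k + 1)).d + 2) * (F.P (k + 1)).L : ℕ) : ℝ)) ^ 2 * (F.P (k + 1)).eta (j' + 1) * (cB * α₀) ^ 2 <
      (F.P (k + 1)).L * (cA * α₀A)) :
    CondI (suModel N) (frameI RzA M j' (domSites (F.P k) M j' Y)) (StepConsts.ofParams (F.P k) cA j') α₀A
      (fieldShift (sitesPerDir_ladder F (K := k) (j := 0) rfl rfl) (avgUnits U)) := by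
  have hξ : 0 < (StepConsts.ofParams (F.P (k + 1)) cB (j' + 1)).ξ := by
    show 0 < (F.P (k + 1)).eta (j' + 1)
    exact pow_pos (inv_pos.mpr (Nat.cast_pos.mpr (F.P (k + 1)).L_pos)) _
  refine ⟨fun b hb => fieldShift_avgUnits_factor_mem_G_frameBond Rz M j' Y hI hα₀ hguard2 b hb, fun p hp => ?_, fun C hC => ?_⟩
  · refine lt_of_le_of_lt (norm_plaq_fieldShift_avgUnits_factor_sub_one_le_framePlaq Rz M j' Y hI hα₀ hguard4 p hp) ?_
    exact hplaq
  · have h := localGauge_fieldShift_avgUnits_factor_frameCubes Rz M j' Y (t' := cA * α₀A) hI hα₀ hguard2 hξ ht h48 hN hπ h1 C hC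
    obtain ⟨u, hu, A, he, hA, hdA⟩ := h
    have hunit : ((F.P (k + 1)).L : ℝ) * (StepConsts.ofParams (F.P (k + 1)) cB (j' + 1)).ξ = (StepConsts.ofParams (F.P k) cA j').ξ := L_mul_eta_succ j'
    refine ⟨u, hu, A, fun bd hbd => ?_, fun bd hbd => ?_, fun q hq => ?_⟩
    · rw [← hunit]; exact he bd hbd
    · exact hA bd hbd
    · rw [← hunit]; exact hdA q hq

end Record

end YMDAG.N18.TransportOfRecord

end
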